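import Literature.Probability.LatticeModels.CriticalUrsellFourSign
import Literature.Probability.LatticeModels.PlusMinusStateGibbs
import Literature.Barriers.CriticalPhenomena.IsingTrivialityFromDimensionFourProofs
import HarnessLib

/-!
# Moments of the critical block spin as sums of critical correlators

Topic `Probability/LatticeModels`; family `crit-ising`. THEOREM-ONLY leaf file (no definitions, no
named facts). For the block spin `M_L = Σ_{x ∈ Λ_L} σ_x` of the nearest-neighbour Ising model on
`ℤ^d` in the critical plus state `⟨·⟩ = plusExpect d β_c 0`:

* `plusExpect_blockSpin_sq_eq_sum` — `⟨M_L²⟩ = Σ_{a,b ∈ Λ_L} ⟨σ_aσ_b⟩_{β_c}`;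
* `plusExpect_blockSpin_pow_four_eq_sum` — `⟨M_L⁴⟩ = Σ_{a,b,c,e ∈ Λ_L} ⟨σ_aσ_bσ_cσ_e⟩_{β_c}`;
* `three_mul_sq_sub_fourth_eq_neg_sum_ursellFour` —
  `3⟨M_L²⟩² - ⟨M_L⁴⟩ = -Σ_{a,b,c,e ∈ Λ_L} U₄(a,b,c,e)`, where
  `U₄ = ⟨σ_aσ_bσ_cσ_e⟩ - (⟨σ_aσ_b⟩⟨σ_cσ_e⟩ + ⟨σ_aσ_c⟩⟨σ_bσ_e⟩ + ⟨σ_aσ_e⟩⟨σ_bσ_c⟩)` is the lattice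
  Ursell function written with `criticalCorr d 4` and `criticalCorr d 2` (no auxiliary definition,
  as in `abs_criticalUrsellFour_le_two_mul`);
* `abs_criticalUrsellFour_le_two_mul_pair02`, `…_pair03` — the bound
  `|U₄| ≤ 2⟨σσ⟩⟨σσ⟩` of Aizenman–Duminil-Copin 2021 (3.12) (`abs_criticalUrsellFour_le_two_mul`) for
  the other two pairings, by the permutation symmetry of `U₄`.

The plus state is linear on local observables: it is the integral against a plus Gibbs measure
(`exists_plusMeasure_holds`, `plusExpect_spinFun_eq_integral`), so the moments of `M_L` expand into
sums of spin correlators (Friedli–Velenik 2017, Thm. 3.17 / Thm. 6.26). The quotient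
`(3⟨M_L²⟩² - ⟨M_L⁴⟩)/⟨M_L²⟩²` is the (renormalised) Binder cumulant of the block, cf. Aizenman,
CDM 2020, §7.

## References

* S. Friedli, Y. Velenik, *Statistical Mechanics of Lattice Systems* (CUP 2017), Thm. 3.17,
  Thm. 6.26 [FriedliVelenik2017].
* M. Aizenman, H. Duminil-Copin, Ann. Math. 194 (2021), eq. (3.12) [AizenmanDuminilCopinAnnals2021].
-/

noncomputable section

namespace Literature.Probability.LatticeModels

open _root_.MeasureTheory Filter Finset Literature.Barriers.CriticalPhenomena
open scoped _root_.Topology BigOperators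

variable {d : ℕ}

/-! ### Iterated quadruple sums of products of two-variable kernels -/

/-- `Σ_a Σ_b Σ_c Σ_e f(a,b) g(c,e) = (Σ_a Σ_b f(a,b)) (Σ_c Σ_e g(c,e))`. [folklore] -/
theorem sum_sum_sum_sum_mul_pair01 {ι : Type*} (s : Finset ι) (f g : ι → ι → ℝ) :
    ∑ a ∈ s, ∑ b ∈ s, ∑ c ∈ s, ∑ e ∈ s, f a b * g c e =
      (∑ a ∈ s, ∑ b ∈ s, f a b) * (∑ c ∈ s, ∑ e ∈ s, g c e) := by
  rw [Finset.sum_mul]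
  refine Finset.sum_congr rfl fun a _ => ?_
  rw [Finset.sum_mul]
  refine Finset.sum_congr rfl fun b _ => ?_
  rw [Finset.mul_sum]
  refine Finset.sum_congr rfl fun c _ => ?_
  rw [Finset.mul_sum]

/-- `Σ_a Σ_b Σ_c Σ_e f(a,c) g(b,e) = (Σ_a Σ_c f(a,c)) (Σ_b Σ_e g(b,e))`. [folklore] -/
theorem sum_sum_sum_sum_mul_pair02 {ι : Type*} (s : Finset ι) (f g : ι → ι → ℝ) :
    ∑ a ∈ s, ∑ b ∈ s, ∑ c ∈ s, ∑ e ∈ s, f a c * g b e =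
      (∑ a ∈ s, ∑ c ∈ s, f a c) * (∑ b ∈ s, ∑ e ∈ s, g b e) := by
  rw [← sum_sum_sum_sum_mul_pair01]
  exact Finset.sum_congr rfl fun a _ => Finset.sum_comm

/-- `Σ_a Σ_b Σ_c Σ_e f(a,e) g(b,c) = (Σ_a Σ_e f(a,e)) (Σ_b Σ_c g(b,c))`. [folklore] -/
theorem sum_sum_sum_sum_mul_pair03 {ι : Type*} (s : Finset ι) (f g : ι → ι → ℝ) :
    ∑ a ∈ s, ∑ b ∈ s, ∑ c ∈ s, ∑ e ∈ s, f a e * g b c =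
      (∑ a ∈ s, ∑ e ∈ s, f a e) * (∑ b ∈ s, ∑ c ∈ s, g b c) := by
  rw [← sum_sum_sum_sum_mul_pair01]
  refine Finset.sum_congr rfl fun a _ => ?_
  calc ∑ b ∈ s, ∑ c ∈ s, ∑ e ∈ s, f a e * g b c
      = ∑ b ∈ s, ∑ e ∈ s, ∑ c ∈ s, f a e * g b c :=
        Finset.sum_congr rfl fun b _ => Finset.sum_comm
    _ = ∑ e ∈ s, ∑ b ∈ s, ∑ c ∈ s, f a e * g b c := Finset.sum_comm

/-- `(Σ_x f x)⁴ = Σ_a Σ_b Σ_c Σ_e f a f b f c f e`. [folklore] -/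
theorem sum_pow_four_eq_sum {ι : Type*} (s : Finset ι) (f : ι → ℝ) :
    (∑ x ∈ s, f x) ^ 4 = ∑ a ∈ s, ∑ b ∈ s, ∑ c ∈ s, ∑ e ∈ s, f a * f b * f c * f e := by
  have h : (∑ x ∈ s, f x) ^ 4 =
      (∑ x ∈ s, f x) * ((∑ x ∈ s, f x) * ((∑ x ∈ s, f x) * (∑ x ∈ s, f x))) := by ring
  rw [h]
  simp only [Finset.sum_mul, Finset.mul_sum]
  refine Finset.sum_congr rfl fun a _ => Finset.sum_congr rfl fun b _ =>
    Finset.sum_congr rfl fun c _ => Finset.sum_congr rfl fun e _ => ?_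
  ring

/-! ### The plus state at `β_c` as an integral -/

/-- A probability measure on `{±1}^{ℤ^d}` with the plus correlations at `(β, 0)`, `β ≥ 0` (the plus
Gibbs measure, `exists_plusMeasure_holds`). [cite: FriedliVelenik2017, Thm. 3.17 and Thm. 6.26] -/
theorem exists_isProbabilityMeasure_spinCorr_eq_plusCorr (d : ℕ) {β : ℝ} (hβ : 0 ≤ β) :
    ∃ μ : Measure (SpinConfig (Site d)), IsProbabilityMeasure μ ∧
      ∀ A : Finset (Site d), spinCorr μ A = plusCorr d β 0 A := by
  obtain ⟨μ, hμG, -, hμ⟩ := exists_plusMeasure_holds (d := d) (β := β) (h := (0 : ℝ)) hβ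
  exact ⟨μ, ((mem_isingGibbsMeasures_iff d _ 0 μ).1 hμG).isProbabilityMeasure, hμ⟩

/-- The critical correlators are integrals of spin monomials against any finite measure with the
plus correlations at `β_c`: `⟨∏ᵢ σ_{yᵢ}⟩_{β_c} = ∫ ∏ᵢ σ_{yᵢ} dμ`. [cite: FriedliVelenik2017, Thm. 3.17 and Thm. 6.26] -/
theorem criticalCorr_eq_integral_spinMonomial {μ : Measure (SpinConfig (Site d))} [IsFiniteMeasure μ]
    (hμ : ∀ A : Finset (Site d), spinCorr μ A = plusCorr d (criticalBeta d) 0 A)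
    {n : ℕ} (y : Fin n → Site d) :
    criticalCorr d n y = ∫ σ, spinMonomial y σ ∂μ := by
  classical
  have key := plusExpect_spinFun_eq_integral (criticalBeta_nonneg d) le_rfl hμ
    (Finset.univ.image y) (fun s => ∏ i, s (y i))
    (fun s t hst => Finset.prod_congr rfl fun i _ =>
      hst _ (Finset.mem_image_of_mem y (Finset.mem_univ i)))
  exact key

/-! ### The second and fourth moments of the block spin -/

/-- **`⟨M_L²⟩_{β_c} = Σ_{a,b ∈ Λ_L} ⟨σ_aσ_b⟩_{β_c}`** for the block spin `M_L = Σ_{x ∈ Λ_L} σ_x`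
(linearity of the plus state on local observables). [cite: FriedliVelenik2017, Thm. 3.17 and Thm. 6.26] -/
theorem plusExpect_blockSpin_sq_eq_sum (d L : ℕ) :
    plusExpect d (criticalBeta d) 0 (fun σ => (∑ x ∈ box d L, spinAt x σ) ^ 2) =
      ∑ a ∈ box d L, ∑ b ∈ box d L, criticalCorr d 2 ![a, b] := by
  classical
  obtain ⟨μ, hμP, hμ⟩ := exists_isProbabilityMeasure_spinCorr_eq_plusCorr d (criticalBeta_nonneg d)
  have hint : ∀ (n : ℕ) (y : Fin n → Site d), Integrable (spinMonomial y) μ := fun n y =>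
    Integrable.of_bound (measurable_spinMonomial y).aestronglyMeasurable 1
      (Eventually.of_forall fun s => by
        rw [Real.norm_eq_abs]
        simp [spinMonomial, Finset.abs_prod])
  have key := plusExpect_spinFun_eq_integral (criticalBeta_nonneg d) le_rfl hμ (box d L)
    (fun s => (∑ x ∈ box d L, s x) ^ 2) (fun s t hst => by rw [Finset.sum_congr rfl hst])
  have hpt : ∀ σ : SpinConfig (Site d), (∑ x ∈ box d L, spinAt x σ) ^ 2 =
      ∑ a ∈ box d L, ∑ b ∈ box d L, spinMonomial ![a, b] σ := by
    intro σ
    rw [sq, Finset.sum_mul_sum]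
    refine Finset.sum_congr rfl fun a _ => Finset.sum_congr rfl fun b _ => ?_
    simp [spinMonomial, Fin.prod_univ_two]
  have e : (fun σ : SpinConfig (Site d) => (∑ x ∈ box d L, spinAt x σ) ^ 2) =
      fun σ => (fun s : Site d → ℝ => (∑ x ∈ box d L, s x) ^ 2) fun x => spinAt x σ := rfl
  rw [e, key]
  simp only [hpt]
  rw [integral_finsetSum _ fun a _ =>
    integrable_finsetSum _ fun b _ => hint 2 ![a, b]]
  refine Finset.sum_congr rfl fun a _ => ?_
  rw [integral_finsetSum _ fun b _ => hint 2 ![a, b]]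
  exact Finset.sum_congr rfl fun b _ => (criticalCorr_eq_integral_spinMonomial hμ ![a, b]).symm

/-- **`⟨M_L⁴⟩_{β_c} = Σ_{a,b,c,e ∈ Λ_L} ⟨σ_aσ_bσ_cσ_e⟩_{β_c}`** for the block spin
`M_L = Σ_{x ∈ Λ_L} σ_x`. [cite: FriedliVelenik2017, Thm. 3.17 and Thm. 6.26] -/
theorem plusExpect_blockSpin_pow_four_eq_sum (d L : ℕ) :
    plusExpect d (criticalBeta d) 0 (fun σ => (∑ x ∈ box d L, spinAt x σ) ^ 4) =
      ∑ a ∈ box d L, ∑ b ∈ box d L, ∑ c ∈ box d L, ∑ e ∈ box d L,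
        criticalCorr d 4 ![a, b, c, e] := by
  classical
  obtain ⟨μ, hμP, hμ⟩ := exists_isProbabilityMeasure_spinCorr_eq_plusCorr d (criticalBeta_nonneg d)
  have hint : ∀ (n : ℕ) (y : Fin n → Site d), Integrable (spinMonomial y) μ := fun n y =>
    Integrable.of_bound (measurable_spinMonomial y).aestronglyMeasurable 1
      (Eventually.of_forall fun s => by
        rw [Real.norm_eq_abs]
        simp [spinMonomial, Finset.abs_prod])
  have key := plusExpect_spinFun_eq_integral (criticalBeta_nonneg d) le_rfl hμ (box d L)
    (fun s => (∑ x ∈ box d L, s x) ^ 4) (fun s t hst => by rw [Finset.sum_congr rfl hst])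
  have hpt : ∀ σ : SpinConfig (Site d), (∑ x ∈ box d L, spinAt x σ) ^ 4 =
      ∑ a ∈ box d L, ∑ b ∈ box d L, ∑ c ∈ box d L, ∑ e ∈ box d L,
        spinMonomial ![a, b, c, e] σ := by
    intro σ
    rw [sum_pow_four_eq_sum]
    refine Finset.sum_congr rfl fun a _ => Finset.sum_congr rfl fun b _ =>
      Finset.sum_congr rfl fun c _ => Finset.sum_congr rfl fun e _ => ?_
    simp [spinMonomial, Fin.prod_univ_four]
  have e : (fun σ : SpinConfig (Site d) => (∑ x ∈ box d L, spinAt x σ) ^ 4) =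
      fun σ => (fun s : Site d → ℝ => (∑ x ∈ box d L, s x) ^ 4) fun x => spinAt x σ := rfl
  rw [e, key]
  simp only [hpt]
  rw [integral_finsetSum _ fun a _ => integrable_finsetSum _ fun b _ =>
    integrable_finsetSum _ fun c _ => integrable_finsetSum _ fun e _ =>
      hint 4 ![a, b, c, e]]
  refine Finset.sum_congr rfl fun a _ => ?_
  rw [integral_finsetSum _ fun b _ => integrable_finsetSum _ fun c _ =>
    integrable_finsetSum _ fun e _ => hint 4 ![a, b, c, e]]
  refine Finset.sum_congr rfl fun b _ => ?_
  rw [integral_finsetSum _ fun c _ => integrable_finsetSum _ fun e _ =>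
    hint 4 ![a, b, c, e]]
  refine Finset.sum_congr rfl fun c _ => ?_
  rw [integral_finsetSum _ fun e _ => hint 4 ![a, b, c, e]]
  exact Finset.sum_congr rfl fun e _ =>
    (criticalCorr_eq_integral_spinMonomial hμ ![a, b, c, e]).symm

/-- **The Binder numerator of the critical block is minus the summed Ursell function**:
`3⟨M_L²⟩² - ⟨M_L⁴⟩ = -Σ_{a,b,c,e ∈ Λ_L} U₄(a,b,c,e)` with
`U₄ = ⟨σ_aσ_bσ_cσ_e⟩ - (⟨σ_aσ_b⟩⟨σ_cσ_e⟩ + ⟨σ_aσ_c⟩⟨σ_bσ_e⟩ + ⟨σ_aσ_e⟩⟨σ_bσ_c⟩)` (each of the three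
pairing sums equals `⟨M_L²⟩²`). [cite: AizenmanCDM2020, §7 eqs. (7.1)–(7.4) (U₄ and the block moments)] -/
theorem three_mul_sq_sub_fourth_eq_neg_sum_ursellFour (d L : ℕ) :
    3 * (plusExpect d (criticalBeta d) 0 (fun σ => (∑ x ∈ box d L, spinAt x σ) ^ 2)) ^ 2 -
        plusExpect d (criticalBeta d) 0 (fun σ => (∑ x ∈ box d L, spinAt x σ) ^ 4) =
      -∑ a ∈ box d L, ∑ b ∈ box d L, ∑ c ∈ box d L, ∑ e ∈ box d L,
        (criticalCorr d 4 ![a, b, c, e] -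
          (criticalCorr d 2 ![a, b] * criticalCorr d 2 ![c, e] +
            criticalCorr d 2 ![a, c] * criticalCorr d 2 ![b, e] +
            criticalCorr d 2 ![a, e] * criticalCorr d 2 ![b, c])) := by
  rw [plusExpect_blockSpin_sq_eq_sum, plusExpect_blockSpin_pow_four_eq_sum]
  simp only [Finset.sum_sub_distrib, Finset.sum_add_distrib]
  rw [sum_sum_sum_sum_mul_pair01, sum_sum_sum_sum_mul_pair02, sum_sum_sum_sum_mul_pair03]
  ring

/-! ### `|U₄| ≤ 2⟨σσ⟩⟨σσ⟩` for every pairing -/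

/-- Critical correlators are invariant under relabelling the points (the spin monomial is a
commutative product). [folklore] -/
theorem criticalCorr_comp_equiv_eq {n : ℕ} (y : Fin n → Site d) (π : Equiv.Perm (Fin n)) :
    criticalCorr d n (y ∘ ⇑π) = criticalCorr d n y := by
  show plusExpect d (criticalBeta d) 0 (spinMonomial (y ∘ ⇑π)) =
    plusExpect d (criticalBeta d) 0 (spinMonomial y)
  congr 1
  funext s
  unfold spinMonomial
  exact Fintype.prod_equiv π _ _ fun i => rfl

/-- `⟨σ_aσ_cσ_bσ_e⟩_{β_c} = ⟨σ_aσ_bσ_cσ_e⟩_{β_c}` (transposition of the middle points). [folklore] -/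
theorem criticalCorr_four_swap_middle (a b c e : Site d) :
    criticalCorr d 4 ![a, c, b, e] = criticalCorr d 4 ![a, b, c, e] := by
  have h : (![a, b, c, e] : Fin 4 → Site d) ∘ ⇑(Equiv.swap (1 : Fin 4) 2) = ![a, c, b, e] := by
    funext i; fin_cases i <;> simp [Equiv.swap_apply_of_ne_of_ne]
  rw [← h, criticalCorr_comp_equiv_eq]

/-- `⟨σ_aσ_bσ_eσ_c⟩_{β_c} = ⟨σ_aσ_bσ_cσ_e⟩_{β_c}` (transposition of the last two points). [folklore] -/
theorem criticalCorr_four_swap_last (a b c e : Site d) :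
    criticalCorr d 4 ![a, b, e, c] = criticalCorr d 4 ![a, b, c, e] := by
  have h : (![a, b, c, e] : Fin 4 → Site d) ∘ ⇑(Equiv.swap (2 : Fin 4) 3) = ![a, b, e, c] := by
    funext i; fin_cases i <;> simp [Equiv.swap_apply_of_ne_of_ne]
  rw [← h, criticalCorr_comp_equiv_eq]

/-- `|U₄(a,b,c,e)| ≤ 2⟨σ_aσ_b⟩⟨σ_cσ_e⟩` on `ℤ^d`, `d ≥ 3` (`abs_criticalUrsellFour_le_two_mul` for an
explicit quadruple). [cite: AizenmanDuminilCopinAnnals2021, eq. (3.12)] -/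
theorem abs_criticalUrsellFour_le_two_mul_pair01 (hd : 3 ≤ d) (a b c e : Site d) :
    |criticalCorr d 4 ![a, b, c, e] -
        (criticalCorr d 2 ![a, b] * criticalCorr d 2 ![c, e] +
          criticalCorr d 2 ![a, c] * criticalCorr d 2 ![b, e] +
          criticalCorr d 2 ![a, e] * criticalCorr d 2 ![b, c])| ≤
      2 * criticalCorr d 2 ![a, b] * criticalCorr d 2 ![c, e] := by
  have h := abs_criticalUrsellFour_le_two_mul hd ![a, b, c, e]
  simpa using h

/-- **`|U₄(a,b,c,e)| ≤ 2⟨σ_aσ_c⟩⟨σ_bσ_e⟩`** on `ℤ^d`, `d ≥ 3`: the bound of Aizenman–Duminil-Copin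
2021 (3.12) for the pairing `{a,c}{b,e}`, by the permutation symmetry of `U₄`. [cite: AizenmanDuminilCopinAnnals2021, eq. (3.12)] -/
theorem abs_criticalUrsellFour_le_two_mul_pair02 (hd : 3 ≤ d) (a b c e : Site d) :
    |criticalCorr d 4 ![a, b, c, e] -
        (criticalCorr d 2 ![a, b] * criticalCorr d 2 ![c, e] +
          criticalCorr d 2 ![a, c] * criticalCorr d 2 ![b, e] +
          criticalCorr d 2 ![a, e] * criticalCorr d 2 ![b, c])| ≤
      2 * criticalCorr d 2 ![a, c] * criticalCorr d 2 ![b, e] := by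
  have h := abs_criticalUrsellFour_le_two_mul_pair01 hd a c b e
  rw [criticalCorr_four_swap_middle, criticalCorr_two_pair_comm c b] at h
  have e4 : criticalCorr d 4 ![a, b, c, e] -
      (criticalCorr d 2 ![a, b] * criticalCorr d 2 ![c, e] +
        criticalCorr d 2 ![a, c] * criticalCorr d 2 ![b, e] +
        criticalCorr d 2 ![a, e] * criticalCorr d 2 ![b, c]) =
      criticalCorr d 4 ![a, b, c, e] -
      (criticalCorr d 2 ![a, c] * criticalCorr d 2 ![b, e] +
        criticalCorr d 2 ![a, b] * criticalCorr d 2 ![c, e] +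
        criticalCorr d 2 ![a, e] * criticalCorr d 2 ![b, c]) := by ring
  rw [e4]
  exact h

/-- **`|U₄(a,b,c,e)| ≤ 2⟨σ_aσ_e⟩⟨σ_bσ_c⟩`** on `ℤ^d`, `d ≥ 3`: the bound of Aizenman–Duminil-Copin
2021 (3.12) for the pairing `{a,e}{b,c}`, by the permutation symmetry of `U₄`. [cite: AizenmanDuminilCopinAnnals2021, eq. (3.12)] -/
theorem abs_criticalUrsellFour_le_two_mul_pair03 (hd : 3 ≤ d) (a b c e : Site d) :
    |criticalCorr d 4 ![a, b, c, e] -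
        (criticalCorr d 2 ![a, b] * criticalCorr d 2 ![c, e] +
          criticalCorr d 2 ![a, c] * criticalCorr d 2 ![b, e] +
          criticalCorr d 2 ![a, e] * criticalCorr d 2 ![b, c])| ≤
      2 * criticalCorr d 2 ![a, e] * criticalCorr d 2 ![b, c] := by
  have h := abs_criticalUrsellFour_le_two_mul_pair01 hd a e b c
  rw [criticalCorr_four_swap_middle, criticalCorr_four_swap_last, criticalCorr_two_pair_comm e b,
    criticalCorr_two_pair_comm e c] at h
  have e4 : criticalCorr d 4 ![a, b, c, e] -
      (criticalCorr d 2 ![a, b] * criticalCorr d 2 ![c, e] +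
        criticalCorr d 2 ![a, c] * criticalCorr d 2 ![b, e] +
        criticalCorr d 2 ![a, e] * criticalCorr d 2 ![b, c]) =
      criticalCorr d 4 ![a, b, c, e] -
      (criticalCorr d 2 ![a, e] * criticalCorr d 2 ![b, c] +
        criticalCorr d 2 ![a, b] * criticalCorr d 2 ![c, e] +
        criticalCorr d 2 ![a, c] * criticalCorr d 2 ![b, e]) := by ring
  rw [e4]
  exact h

end Literature.Probability.LatticeModels

end
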